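import Summits.NavierStokesRegularity.FluidComputer.PalasekTowerRegisterGlobalSmallData
import Literature.Analysis.FluidPDE.KatoSmallDataForcedClassical

/-!
# `SmallDataClassicalEngine ν` HOLDS for every `ν > 0` (Kato's small-data theory with a confined
# Clay-class force, classical output, is a theorem of the tree)

Cell `ns-blowup`, seat `ns-blowup-lit` (g12; literature-prover, GROUP C «BRIDGE SUPPORT» of the route
`PalasekTowerBreakdown`). LABEL: E–C typing (KERNEL discharge of a typed hypothesis). WHAT THIS IS NOT:
not Navier–Stokes evidence about registered flows and not a statement about the cruxes — it turns the
typed HYPOTHESIS `SmallDataClassicalEngine ν` of `PalasekTowerRegisterGlobalSmallData.lean` (ecbridge-4 g3;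
the `H` of `EpisodeBaseNegative.firstEpisodeR_false_of_engine`,
`Theorems/EpisodeBase/Negative/FirstEpisodeRFalseOfSmallDataClassicalEngine.lean`) into a THEOREM for every
positive viscosity, by the Literature theorem
`Literature.Analysis.FluidPDE.KatoSmallDataForced.kato_smallData_forced_classical`
(`Literature/Analysis/FluidPDE/KatoSmallDataForcedClassical.lean`: Kato 1984, Thm. 2–4 in the weighted
class `t^{1/4}L⁶ ∩ t^{1/2}L^∞`, run as an a-priori estimate on the forced Oseen representation of Tao-class
classical solutions — `KatoAprioriForcedClassical.lean` — plus Tao's forced smooth existence and a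
uniform-step continuation; Lemarié-Rieusset 2016, Thm. 15.2 with Thm. 7.2/7.3), whose statement is the body
of the definition verbatim.

* `smallDataClassicalEngine_holds (hν : 0 < ν) : SmallDataClassicalEngine ν`;
* `smallDataClassicalEngine_one_holds : SmallDataClassicalEngine 1` — the instance consumed by
  `EpisodeBaseNegative.firstEpisodeR_false_of_engine` (whose conclusion `¬ FirstEpisodeR` is meanwhile also
  in the tree hypothesis-free by a different route, `EpisodeBaseNegative.not_firstEpisodeR`).

(The definition carries no positivity hypothesis on `ν`; for `ν ≤ 0` it is not asserted here.)

References: T. Kato, Math. Z. 187 (1984) 471–480, Thm. 2–4 [cite: Kato1984, Thm. 2–4];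
P. G. Lemarié-Rieusset, *The Navier–Stokes Problem in the 21st Century* (2016), Thm. 15.2, Thm. 7.2–7.3
[cite: LemarieRieusset2016, Thm. 15.2]; T. Tao, Anal. PDE 6 (2013), Thm. 5.4 [cite: Tao2011, Thm. 5.4].
-/

noncomputable section

namespace Summit.NavierStokesRegularity.FluidComputer.PalasekTowerClayBridge

/-- **The small-data classical engine holds at every positive viscosity** (Kato 1984, Thm. 2–4 with a
confined Clay-class force; the Literature theorem
`KatoSmallDataForced.kato_smallData_forced_classical` is the body of the definition verbatim).
[cite: Kato1984, Thm. 2–4] [cite: LemarieRieusset2016, Thm. 15.2 with Thm. 7.2/7.3] -/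
theorem smallDataClassicalEngine_holds {ν : ℝ} (hν : 0 < ν) : SmallDataClassicalEngine ν :=
  Literature.Analysis.FluidPDE.KatoSmallDataForced.kato_smallData_forced_classical hν

/-- **The engine at unit viscosity** — the hypothesis of
`EpisodeBaseNegative.firstEpisodeR_false_of_engine`. [cite: Kato1984, Thm. 2–4] -/
theorem smallDataClassicalEngine_one_holds : SmallDataClassicalEngine 1 :=
  smallDataClassicalEngine_holds one_pos

end Summit.NavierStokesRegularity.FluidComputer.PalasekTowerClayBridge

end
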